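import Summits.RiemannHypothesis.RiemannHypothesis.Theorems.LiTailMidpointFresnelLaw
import Literature.Analysis.Fourier.FresnelConstantValue
import Literature.NumberTheory.LFunctions.AndersonStarkLiouville
import HarnessLib

/-!
# RiemannHypothesis / LiTailMidpoint — the uniform tail–Fresnel law in REAL FORM (Anderson–Stark Fresnel integrals `C`, `S`)
# (RH-FREE for all `n`; dictionary between the tree's complex normalisation and the data exhibits)

RH-FREE [rh-li-prover g7].  Cell `pub/rh-li`, LI column; companion of `Theorems/LiTailMidpointFresnelLaw.lean`
(`FresnelLaw.liZeroTail_fresnel`, the UNIFORM TAIL–FRESNEL LAW in `O(log² n)` form).  That theorem states the main term in the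
tree's complex normalisation `Re{e^{iF(t₀)} F''(t₀)^{−1/2} [fresnelLim − σ(T)·fresnelS(Y)]}`, `Y = √(2(F(T) − F(t₀)))`,
`Literature.Analysis.Fourier.fresnelS Y = ∫_0^Y e^{iu²/2} du`, `fresnelLim = √π(1 + i)/2` (`fresnelLim_eq`).  The column's data exhibits
(rh-li-eng-6 g4, `step0/reports/STEP0-REPORT-r7-uniform-fresnel-law.md`: model `P_m(n;c) = (A_m n^{1/4}/√2)·[(½ − C(X)) cos Φ_m(t₀) −
(½ − S(X)) sin Φ_m(t₀)]`, `X = ±√((2/π)(Φ_m(c√n) − Φ_m(t₀)))`) use the classical real Fresnel integrals `C(x) = ∫_0^x cos(πv²/2) dv`,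
`S(x) = ∫_0^x sin(πv²/2) dv` (in tree: `Literature.NumberTheory.LFunctions.fresnelC / fresnelS`, Anderson–Stark normalisation).  THIS FILE is
the dictionary (substitution `u = √π·v`):

* `re_fresnelS_eq`, `im_fresnelS_eq` — `Re 𝓕S(Y) = √π·C(Y/√π)`, `Im 𝓕S(Y) = √π·S(Y/√π)`;
* `re_main_eq` — `Re{e^{iφ}·r·[fresnelLim − σ·𝓕S(Y)]} = r√π·[(½ − σC(Y/√π)) cos φ − (½ − σS(Y/√π)) sin φ]`;
* `liZeroTail_fresnel_real` — the uniform tail–Fresnel law with the main term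
  `(Λ(m)/π) m^{−1/2} F''(t₀)^{−1/2} √π · [(½ − σ(T) C(X)) cos F(t₀) − (½ − σ(T) S(X)) sin F(t₀)]`, `X = √(2(F(T) − F(t₀)))/√π`,
  `σ(T) = ±1` — literally the exhibit's `P_m` with the exact (pre-asymptotic) amplitude `F''(t₀)^{−1/2}` in place of `n^{1/4}(log m)^{−3/4}/√2`
  (`F''(t₀) = 2t₀ (log m)²/n`, `t₀² + ¼ = n/log m`).

Nothing here bears on the truth of RH; no data of record is added or changed.
-/

noncomputable section

-- D-0017: `Summit.<S>.<S>.…` is the designed namespace of a single-problem summit.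
set_option linter.dupNamespace false

open MeasureTheory intervalIntegral Set Complex
open scoped ArithmeticFunction.vonMangoldt Real

namespace Summit.RiemannHypothesis.RiemannHypothesis.Theorems.LiTheory

namespace FresnelLaw

open Fejer
open Literature.Analysis.Fourier (fresnelIntegrand fresnelLim fresnelLim_eq intervalIntegrable_fresnelIntegrand)
open Literature.NumberTheory.LFunctions (fresnelC fresnelS)

/-! ### The complex Fresnel integral in Anderson–Stark normalisation -/

/-- `Re ∫_0^Y e^{iu²/2} du = √π · C(Y/√π)` (`C(x) = ∫_0^x cos(πv²/2) dv`; substitution `u = √π v`). -/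
theorem re_fresnelS_eq (Y : ℝ) :
    (Literature.Analysis.Fourier.fresnelS Y).re = Real.sqrt π * fresnelC (Y / Real.sqrt π) := by
  have hπ : 0 < Real.sqrt π := Real.sqrt_pos.2 Real.pi_pos
  have hint := intervalIntegrable_fresnelIntegrand 0 Y
  have h := (Complex.reCLM.intervalIntegral_comp_comm hint).symm
  simp only [Complex.reCLM_apply] at h
  unfold Literature.Analysis.Fourier.fresnelS
  rw [h]
  have hpt : ∀ u : ℝ, (fresnelIntegrand u).re = Real.cos (u ^ 2 / 2) := fun u ↦ by
    unfold fresnelIntegrand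
    rw [mul_comm, Complex.exp_ofReal_mul_I_re]
  simp_rw [hpt]
  unfold fresnelC
  have hsub := intervalIntegral.mul_integral_comp_mul_left (f := fun u : ℝ ↦ Real.cos (u ^ 2 / 2))
    (a := (0 : ℝ)) (b := Y / Real.sqrt π) (Real.sqrt π)
  have hY : Real.sqrt π * (Y / Real.sqrt π) = Y := by field_simp
  rw [mul_zero, hY] at hsub
  rw [← hsub]
  congr 1
  refine intervalIntegral.integral_congr fun v _ ↦ ?_
  rw [mul_pow, Real.sq_sqrt Real.pi_pos.le]

/-- `Im ∫_0^Y e^{iu²/2} du = √π · S(Y/√π)` (`S(x) = ∫_0^x sin(πv²/2) dv`). -/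
theorem im_fresnelS_eq (Y : ℝ) :
    (Literature.Analysis.Fourier.fresnelS Y).im = Real.sqrt π * fresnelS (Y / Real.sqrt π) := by
  have hπ : 0 < Real.sqrt π := Real.sqrt_pos.2 Real.pi_pos
  have hint := intervalIntegrable_fresnelIntegrand 0 Y
  have h := (Complex.imCLM.intervalIntegral_comp_comm hint).symm
  simp only [Complex.imCLM_apply] at h
  unfold Literature.Analysis.Fourier.fresnelS
  rw [h]
  have hpt : ∀ u : ℝ, (fresnelIntegrand u).im = Real.sin (u ^ 2 / 2) := fun u ↦ by
    unfold fresnelIntegrand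
    rw [mul_comm, Complex.exp_ofReal_mul_I_im]
  simp_rw [hpt]
  unfold fresnelS
  have hsub := intervalIntegral.mul_integral_comp_mul_left (f := fun u : ℝ ↦ Real.sin (u ^ 2 / 2))
    (a := (0 : ℝ)) (b := Y / Real.sqrt π) (Real.sqrt π)
  have hY : Real.sqrt π * (Y / Real.sqrt π) = Y := by field_simp
  rw [mul_zero, hY] at hsub
  rw [← hsub]
  congr 1
  refine intervalIntegral.integral_congr fun v _ ↦ ?_
  rw [mul_pow, Real.sq_sqrt Real.pi_pos.le]

/-- `Re fresnelLim = √π/2` and `Im fresnelLim = √π/2` (`fresnelLim = √π (1 + i)/2`). -/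
theorem re_im_fresnelLim : fresnelLim.re = Real.sqrt π / 2 ∧ fresnelLim.im = Real.sqrt π / 2 := by
  rw [fresnelLim_eq]
  constructor <;> simp [Complex.mul_re, Complex.mul_im, div_eq_mul_inv]

/-- **The dictionary**: for real `φ`, `r`, `σ`, `Y`,
`Re{e^{iφ} · r · [fresnelLim − σ·𝓕S(Y)]} = r√π · [(½ − σ C(Y/√π)) cos φ − (½ − σ S(Y/√π)) sin φ]`. -/
theorem re_main_eq (φ r σ Y : ℝ) :
    (cexp (I * φ) * (r : ℂ) * (fresnelLim - (σ : ℂ) * Literature.Analysis.Fourier.fresnelS Y)).re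
      = r * Real.sqrt π * ((1 / 2 - σ * fresnelC (Y / Real.sqrt π)) * Real.cos φ
          - (1 / 2 - σ * fresnelS (Y / Real.sqrt π)) * Real.sin φ) := by
  obtain ⟨hLre, hLim⟩ := re_im_fresnelLim
  have hA_re : (cexp (I * φ) * (r : ℂ)).re = r * Real.cos φ := by
    rw [mul_comm I, Complex.mul_re, Complex.exp_ofReal_mul_I_re, Complex.exp_ofReal_mul_I_im, Complex.ofReal_re,
      Complex.ofReal_im]
    ring
  have hA_im : (cexp (I * φ) * (r : ℂ)).im = r * Real.sin φ := by
    rw [mul_comm I, Complex.mul_im, Complex.exp_ofReal_mul_I_re, Complex.exp_ofReal_mul_I_im, Complex.ofReal_re,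
      Complex.ofReal_im]
    ring
  have hW_re : (fresnelLim - (σ : ℂ) * Literature.Analysis.Fourier.fresnelS Y).re
      = Real.sqrt π / 2 - σ * (Real.sqrt π * fresnelC (Y / Real.sqrt π)) := by
    rw [Complex.sub_re, Complex.re_ofReal_mul, hLre, re_fresnelS_eq]
  have hW_im : (fresnelLim - (σ : ℂ) * Literature.Analysis.Fourier.fresnelS Y).im
      = Real.sqrt π / 2 - σ * (Real.sqrt π * fresnelS (Y / Real.sqrt π)) := by
    rw [Complex.sub_im, Complex.im_ofReal_mul, hLim, im_fresnelS_eq]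
  rw [Complex.mul_re, hA_re, hA_im, hW_re, hW_im]
  ring

/-! ### The law in real form -/

/-- **The UNIFORM TAIL–FRESNEL LAW of the Li zeros, real form** (RH-FREE for all `n`; `O(log² n)`): under the hypotheses of
`liZeroTail_fresnel` (`m ≥ 2`, `0 < c₁`, `0 < c₂`, `1/c₁² < log(m+1)`, `log(m−1) < 1/c₂²`, `log m < 4/c₂²`) there are `N`, `C` with, for all
`n ≥ N` and every cut `T ∈ [c₁√n, c₂√n]`,
`|liZeroTail n T − liSmoothTail n T + Σ_{k ∈ Ico 2 m} liCoffeyTerm k n − (Λ(m)/π) m^{−1/2} F''(t₀)^{−1/2} √π ·`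
`   [(½ − σ(T)·C(X)) cos F(t₀) − (½ − σ(T)·S(X)) sin F(t₀)]| ≤ C log² n`,
`F = Fejer.phF n (log m)`, `t₀ = Fejer.tz n (log m)`, `X = √(2(F(T) − F(t₀)))/√π`, `σ(T) = 1` if `t₀ ≤ T` else `−1`, `C`, `S` the Fresnel integrals
`∫_0^x cos(πv²/2) dv`, `∫_0^x sin(πv²/2) dv` — the data exhibits' `P_m` with the exact amplitude. -/
theorem liZeroTail_fresnel_real (m : ℕ) (hm : 2 ≤ m) {c₁ c₂ : ℝ} (hc₁ : 0 < c₁) (hc₂ : 0 < c₂)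
    (hlow : 1 / c₁ ^ 2 < Real.log (m + 1 : ℕ)) (hup : Real.log (m - 1 : ℕ) < 1 / c₂ ^ 2)
    (hup' : Real.log m < 4 / c₂ ^ 2) :
    ∃ N : ℕ, ∃ C : ℝ, ∀ n : ℕ, N ≤ n → ∀ T : ℝ, c₁ * Real.sqrt n ≤ T → T ≤ c₂ * Real.sqrt n →
      |liZeroTail n T - liSmoothTail n T + (∑ k ∈ Finset.Ico 2 m, liCoffeyTerm k n)
          - (Λ m : ℝ) / Real.pi * (m : ℝ) ^ (-(1 / 2 : ℝ)) *
            ((Real.sqrt (phF2 n (tz n (Real.log m))))⁻¹ * Real.sqrt π *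
              ((1 / 2 - (if tz n (Real.log m) ≤ T then (1 : ℝ) else -1)
                  * fresnelC (Real.sqrt (2 * (phF n (Real.log m) T - phF n (Real.log m) (tz n (Real.log m))))
                      / Real.sqrt π)) * Real.cos (phF n (Real.log m) (tz n (Real.log m)))
                - (1 / 2 - (if tz n (Real.log m) ≤ T then (1 : ℝ) else -1)
                  * fresnelS (Real.sqrt (2 * (phF n (Real.log m) T - phF n (Real.log m) (tz n (Real.log m))))
                      / Real.sqrt π)) * Real.sin (phF n (Real.log m) (tz n (Real.log m)))))|
        ≤ C * Real.log n ^ 2 := by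
  obtain ⟨N, C, h⟩ := liZeroTail_fresnel m hm hc₁ hc₂ hlow hup hup'
  refine ⟨N, C, fun n hn T hTl hTu ↦ ?_⟩
  have key := h n hn T hTl hTu
  set φ : ℝ := phF n (Real.log m) (tz n (Real.log m)) with hφ
  set r : ℝ := (Real.sqrt (phF2 n (tz n (Real.log m))))⁻¹ with hr
  set Y : ℝ := Real.sqrt (2 * (phF n (Real.log m) T - phF n (Real.log m) (tz n (Real.log m)))) with hY
  by_cases ht : tz n (Real.log m) ≤ T
  · rw [if_pos ht] at key
    rw [if_pos ht]
    have e := re_main_eq φ r 1 Y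
    rw [Complex.ofReal_one] at e
    rw [← e]
    exact key
  · rw [if_neg ht] at key
    rw [if_neg ht]
    have e := re_main_eq φ r (-1) Y
    rw [Complex.ofReal_neg, Complex.ofReal_one] at e
    rw [← e]
    exact key

end FresnelLaw

end Summit.RiemannHypothesis.RiemannHypothesis.Theorems.LiTheory

end
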